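import Summits.CriticalPhenomena.SAWScalingLimit.Theorems.SAWLoopFugacityFlowIsingBoundaryRatioWindowRectOrder2
import HarnessLib

/-!
# Window rectangle: the structure of the boundary cycle
(line `fk-anchor-transfer`, crux `IsingBoundaryRatio`, stmt-CriticalPhenomena-10650; helper file of the stub
`windowRectPresentation_holds : WindowRectPresentation`)

In the static setting `X : WSetting` the height of the boundary cycle of `E` is high (`> w₂ - κ`) at the base
position `0` (an outer rim dart) and low (`< w₁ + κ`) at some position (an inner rim dart). We extract the
**skeleton** of the cycle (`WSetting.Skel`, `exists_skel`): positions `Q < P ≤ P' < R ≤ N` with `Q, R` high,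
`P, P'` low, the height mid on `(Q, P)` (the descent) and on `(P', R)` (the ascent), never low before `P` or
after `P'`, never high on `(Q, R)`; the descent and the ascent are of different hands (valley); and every
position of deep height (`[w₁ + 4m, w₂ - 4m]`) lies on the descent or on the ascent (no deep excursions). That
there is no low position after `R` is the exclusion of a second descent: it would produce four transits of
alternating hands (valley, peak, valley), i.e. interleaved left and right darts. [folklore]
-/

noncomputable section

open scoped Classical Topology Real
open Filter Set Metric Complex
open Literature.Probability.LatticeModels Literature.Probability.RandomPlanarGeometry
open Literature.Probability.LatticeModels.DiscreteRect Literature.Topology.PlaneTopology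
open UpperHalfPlane (upperHalfPlaneSet)

namespace Summit.CriticalPhenomena.SAWScalingLimit.Theorems.IsingBoundaryRatio

namespace WindowRect

/-! ### Strict level crossings -/

/-- First index with `h < ℓ`. [folklore] -/
theorem exists_first_lt {h : ℕ → ℝ} {ℓ : ℝ} {s t : ℕ} (hst : s ≤ t) (hs : ℓ ≤ h s) (ht : h t < ℓ) :
    ∃ j, s < j ∧ j ≤ t ∧ h j < ℓ ∧ ∀ i, s ≤ i → i < j → ℓ ≤ h i := by
  have hex : ∃ i, s ≤ i ∧ h i < ℓ := ⟨t, hst, ht⟩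
  refine ⟨Nat.find hex, ?_, Nat.find_min' hex ⟨hst, ht⟩, (Nat.find_spec hex).2, fun i hsi hij => ?_⟩
  · rcases (Nat.find_spec hex).1.lt_or_eq with h' | h'
    · exact h'
    · exact absurd (Nat.find_spec hex).2 (by rw [← h']; exact not_lt.2 hs)
  · by_contra hcon; exact Nat.find_min hex hij ⟨hsi, not_le.1 hcon⟩

/-- First index with `ℓ < h`. [folklore] -/
theorem exists_first_gt {h : ℕ → ℝ} {ℓ : ℝ} {s t : ℕ} (hst : s ≤ t) (hs : h s ≤ ℓ) (ht : ℓ < h t) :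
    ∃ j, s < j ∧ j ≤ t ∧ ℓ < h j ∧ ∀ i, s ≤ i → i < j → h i ≤ ℓ := by
  obtain ⟨j, h1, h2, h3, h4⟩ := exists_first_lt (h := fun i => -h i) (ℓ := -ℓ) hst (neg_le_neg hs) (neg_lt_neg ht)
  exact ⟨j, h1, h2, neg_lt_neg_iff.1 h3, fun i a b => neg_le_neg_iff.1 (h4 i a b)⟩

/-- Last index with `ℓ < h`. [folklore] -/
theorem exists_last_gt {h : ℕ → ℝ} {ℓ : ℝ} {s t : ℕ} (hst : s ≤ t) (hs : ℓ < h s) (ht : h t ≤ ℓ) :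
    ∃ j, s ≤ j ∧ j < t ∧ ℓ < h j ∧ ∀ i, j < i → i ≤ t → h i ≤ ℓ := by
  set P : ℕ → Prop := fun i => s ≤ i ∧ ℓ < h i with hP
  have hPj : P (Nat.findGreatest P t) := Nat.findGreatest_spec hst ⟨le_rfl, hs⟩
  have hjt : Nat.findGreatest P t ≤ t := Nat.findGreatest_le t
  refine ⟨Nat.findGreatest P t, hPj.1, lt_of_le_of_ne hjt fun e => ?_, hPj.2, fun i hji hit => ?_⟩
  · have := hPj.2; rw [e] at this; exact (not_lt.2 ht) this
  · by_contra hcon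
    exact Nat.findGreatest_is_greatest hji hit ⟨hPj.1.trans hji.le, not_le.1 hcon⟩

/-- Last index with `h < ℓ`. [folklore] -/
theorem exists_last_lt {h : ℕ → ℝ} {ℓ : ℝ} {s t : ℕ} (hst : s ≤ t) (hs : h s < ℓ) (ht : ℓ ≤ h t) :
    ∃ j, s ≤ j ∧ j < t ∧ h j < ℓ ∧ ∀ i, j < i → i ≤ t → ℓ ≤ h i := by
  obtain ⟨j, h1, h2, h3, h4⟩ := exists_last_gt (h := fun i => -h i) (ℓ := -ℓ) hst (neg_lt_neg hs) (neg_le_neg ht)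
  exact ⟨j, h1, h2, neg_lt_neg_iff.1 h3, fun i a b => neg_le_neg_iff.1 (h4 i a b)⟩

namespace WSetting

variable (X : WSetting)

/-- **The skeleton of the boundary cycle.** [folklore] -/
structure Skel where
  /-- last high position before the first low one -/
  Q : ℕ
  /-- first low position -/
  P : ℕ
  /-- last low position -/
  P' : ℕ
  /-- first high position after the low ones -/
  R : ℕ
  hQP : Q + 1 < P
  hPP' : P ≤ P'
  hP'R : P' + 1 < R
  hRN : R ≤ X.N
  hQ : X.w₂ - X.κ < X.hgt Q
  hP : X.hgt P < X.w₁ + X.κ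
  hP' : X.hgt P' < X.w₁ + X.κ
  hR : X.w₂ - X.κ < X.hgt R
  lowfree₁ : ∀ i, i < P → X.w₁ + X.κ ≤ X.hgt i
  highfree : ∀ i, Q < i → i < R → X.hgt i ≤ X.w₂ - X.κ
  lowfree₂ : ∀ i, P' < i → i ≤ X.N → X.w₁ + X.κ ≤ X.hgt i
  hands : ¬ (Q + 1 ∈ X.lft ↔ P' + 1 ∈ X.lft)
  deep : ∀ p, p < X.N → X.w₁ + 4 * X.m ≤ X.hgt p → X.hgt p ≤ X.w₂ - 4 * X.m → (Q < p ∧ p < P) ∨ (P' < p ∧ p < R)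

/-- The height at the base position is high, at `N` too. [folklore] -/
theorem hgt_zero : X.w₂ - X.κ < X.hgt 0 ∧ X.w₂ - X.κ < X.hgt X.N := by
  have h := X.lt_hgt_of_outer X.zero_mem_outer
  refine ⟨h, ?_⟩
  have := X.hgt_add_N 0; rw [zero_add] at this; rwa [this]

/-- Some position below `N` is low (an inner rim dart). [folklore] -/
theorem exists_low : ∃ p, 0 < p ∧ p < X.N ∧ X.hgt p < X.w₁ + X.κ := by
  obtain ⟨d, hd, hadj, hrad⟩ := X.exists_I_dart
  obtain ⟨p, hpN, hp⟩ := X.cover hd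
  have hin : p ∈ X.inner := by
    refine ⟨?_, ?_⟩
    · rw [mem_rim_iff, farSite_def, site_def, hp]; exact hadj
    · rw [farSite_def, site_def, hp]; exact hrad
  refine ⟨p, Nat.pos_of_ne_zero fun h0 => ?_, hpN, X.hgt_lt_of_inner hin⟩
  rw [h0] at hin
  exact X.not_outer_of_inner hin X.zero_mem_outer

/-- **No second descent**: given the first descent `(Q, P)` and the first ascent `(P', R)` after the low
positions `[P, P']`, there is no low position in `(R, N]`. [folklore] -/
theorem no_low_after {Q P P' R : ℕ} (hQP : Q + 1 < P) (hPP' : P ≤ P') (hP'R : P' + 1 < R) (hRN : R ≤ X.N)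
    (hQ : X.w₂ - X.κ < X.hgt Q) (hP : X.hgt P < X.w₁ + X.κ) (hP' : X.hgt P' < X.w₁ + X.κ) (hR : X.w₂ - X.κ < X.hgt R)
    (hmid₁ : ∀ i, Q < i → i < P → X.w₁ + X.κ ≤ X.hgt i ∧ X.hgt i ≤ X.w₂ - X.κ)
    (hmid₂ : ∀ i, P' < i → i < R → X.w₁ + X.κ ≤ X.hgt i ∧ X.hgt i ≤ X.w₂ - X.κ) :
    ∀ i, R < i → i ≤ X.N → X.w₁ + X.κ ≤ X.hgt i := by
  obtain ⟨hm, hκ, hκm, hw₁, hw₂⟩ := X.numer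
  have hN := X.hgt_zero
  intro i₀ hi₀R hi₀N
  by_contra hi₀
  push Not at hi₀
  -- the second descent `(Q₃, P₃)`: `P₃` first low after `R`, `Q₃` last high before `P₃`
  obtain ⟨P₃, hRP₃, hP₃i₀, hP₃low, hP₃min⟩ := exists_first_lt (h := X.hgt) hi₀R.le (by linarith) hi₀
  have hP₃N : P₃ < X.N := lt_of_le_of_ne (hP₃i₀.trans hi₀N) fun e => by rw [e] at hP₃low; linarith [hN.2]
  obtain ⟨Q₃, hRQ₃, hQ₃P₃, hQ₃high, hQ₃max⟩ := exists_last_gt (h := X.hgt) hRP₃.le hR (by linarith)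
  have hmid₃ : ∀ i, Q₃ < i → i < P₃ → X.w₁ + X.κ ≤ X.hgt i ∧ X.hgt i ≤ X.w₂ - X.κ := fun i h1 h2 =>
    ⟨hP₃min i (by omega) h2, hQ₃max i h1 h2.le⟩
  -- the second ascent `(P₄, R₄)`: `R₄` first high after `P₃`, `P₄` last low before `R₄`
  obtain ⟨R₄, hP₃R₄, hR₄N, hR₄high, hR₄min⟩ := exists_first_gt (h := X.hgt) hP₃N.le (by linarith) hN.2
  obtain ⟨P₄, hP₃P₄, hP₄R₄, hP₄low, hP₄max⟩ := exists_last_lt (h := X.hgt) hP₃R₄.le hP₃low (by linarith)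
  have hmid₄ : ∀ i, P₄ < i → i < R₄ → X.w₁ + X.κ ≤ X.hgt i ∧ X.hgt i ≤ X.w₂ - X.κ := fun i h1 h2 =>
    ⟨hP₄max i h1 h2.le, hR₄min i (by omega) h2⟩
  -- hands
  have h12 := X.hands_ne_of_valley (by omega) hPP' (by omega) (by omega) hQ hP hP' hR hmid₁ hmid₂
  have h23 := X.hands_ne_of_peak (Q := P') (P := R) (P' := Q₃) (R := P₃) (by omega) hRQ₃ hQ₃P₃ (by omega)
    hP' hR hQ₃high hP₃low hmid₂ hmid₃
  have h34 := X.hands_ne_of_valley (Q := Q₃) (P := P₃) (P' := P₄) (R := R₄) hQ₃P₃ hP₃P₄ hP₄R₄ (by omega)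
    hQ₃high hP₃low hP₄low hR₄high hmid₃ hmid₄
  -- the four transits interleave
  have hQ₃1 : Q₃ + 1 < P₃ := by
    by_contra h
    have e : Q₃ + 1 = P₃ := by omega
    have := (X.hgt_succ_bounds Q₃).1; rw [e] at this; linarith
  have hP₄1 : P₄ + 1 < R₄ := by
    by_contra h
    have e : P₄ + 1 = R₄ := by omega
    have := (X.hgt_succ_bounds P₄).2; rw [e] at this; linarith
  have hr₁ : Q + 1 ∉ X.rim := X.not_rim_of_mid (hmid₁ _ (by omega) hQP).1 (hmid₁ _ (by omega) hQP).2
  have hr₂ : P' + 1 ∉ X.rim := X.not_rim_of_mid (hmid₂ _ (by omega) hP'R).1 (hmid₂ _ (by omega) hP'R).2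
  have hr₃ : Q₃ + 1 ∉ X.rim := X.not_rim_of_mid (hmid₃ _ (by omega) hQ₃1).1 (hmid₃ _ (by omega) hQ₃1).2
  have hr₄ : P₄ + 1 ∉ X.rim := X.not_rim_of_mid (hmid₄ _ (by omega) hP₄1).1 (hmid₄ _ (by omega) hP₄1).2
  have toR : ∀ i, i ∉ X.rim → i ∉ X.lft → i ∈ X.rgt := fun i hi hl => (X.lft_or_rgt hi).resolve_left hl
  by_cases hA : Q + 1 ∈ X.lft
  · have hB : P' + 1 ∉ X.lft := fun h => h12 (iff_of_true hA h)
    have hC : Q₃ + 1 ∈ X.lft := by by_contra h; exact h23 (iff_of_false hB h)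
    have hD : P₄ + 1 ∉ X.lft := fun h => h34 (iff_of_true hC h)
    exact X.false_of_interleave_lr (a := Q + 1) (b := P' + 1) (c := Q₃ + 1) (e := P₄ + 1) (by omega) (by omega)
      (by omega) (by omega) hA (toR _ hr₂ hB) hC (toR _ hr₄ hD)
  · have hB : P' + 1 ∈ X.lft := by by_contra h; exact h12 (iff_of_false hA h)
    have hC : Q₃ + 1 ∉ X.lft := fun h => h23 (iff_of_true hB h)
    have hD : P₄ + 1 ∈ X.lft := by by_contra h; exact h34 (iff_of_false hC h)
    exact X.false_of_interleave_rl (a := Q + 1) (b := P' + 1) (c := Q₃ + 1) (e := P₄ + 1) (by omega) (by omega)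
      (by omega) (by omega) (toR _ hr₁ hA) hB (toR _ hr₃ hC) hD

/-- **No deep excursions**: with the skeleton data, a deep position below `N` is on the descent or on the
ascent. [folklore] -/
theorem deep_mem {Q P P' R : ℕ} (hQP : Q + 1 < P) (hPP' : P ≤ P') (hP'R : P' + 1 < R) (hRN : R ≤ X.N)
    (hQ : X.w₂ - X.κ < X.hgt Q) (hP : X.hgt P < X.w₁ + X.κ) (hP' : X.hgt P' < X.w₁ + X.κ) (hR : X.w₂ - X.κ < X.hgt R)
    (lowfree₁ : ∀ i, i < P → X.w₁ + X.κ ≤ X.hgt i) (highfree : ∀ i, Q < i → i < R → X.hgt i ≤ X.w₂ - X.κ)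
    (lowfree₂ : ∀ i, P' < i → i ≤ X.N → X.w₁ + X.κ ≤ X.hgt i) {p : ℕ} (hpN : p < X.N)
    (hd1 : X.w₁ + 4 * X.m ≤ X.hgt p) (hd2 : X.hgt p ≤ X.w₂ - 4 * X.m) : (Q < p ∧ p < P) ∨ (P' < p ∧ p < R) := by
  obtain ⟨hm, hκ, hκm, hw₁, hw₂⟩ := X.numer
  have hN := X.hgt_zero
  -- two reference rough positions: `P - 1` (low side) and `R - 1` (high side)
  have hPm : X.hgt (P - 1) < X.w₁ + 2 * X.κ := by
    have := (X.hgt_succ_bounds (P - 1)).1; rw [Nat.sub_add_cancel (by omega)] at this; linarith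
  have hPm' : P - 1 ∉ X.rim := X.not_rim_of_mid (lowfree₁ _ (by omega)) (by linarith)
  have hRm : X.w₂ - 2 * X.κ < X.hgt (R - 1) := by
    have := (X.hgt_succ_bounds (R - 1)).2; rw [Nat.sub_add_cancel (by omega)] at this; linarith
  have hRm' : R - 1 ∉ X.rim := X.not_rim_of_mid (by linarith) (highfree _ (by omega) (by omega))
  have hPmN : P - 1 + X.N ∉ X.rim := by rwa [X.not_rim_add_N]
  have hPmN' : X.hgt (P - 1 + X.N) = X.hgt (P - 1) := X.hgt_add_N _
  by_contra hcon
  have hc1 : ¬ (Q < p ∧ p < P) := fun h => hcon (Or.inl h)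
  have hc2 : ¬ (P' < p ∧ p < R) := fun h => hcon (Or.inr h)
  rcases Nat.lt_or_ge p (Q + 1) with h1 | h1
  · -- `p ∈ [0, Q]`: a high excursion
    obtain ⟨s, -, hsp, hs1, hs3⟩ := exists_last_gt (h := X.hgt) (Nat.zero_le p) hN.1 (by linarith)
    obtain ⟨t, hpt, htQ, ht2, ht4⟩ := exists_first_gt (h := X.hgt) (show p ≤ Q by omega) (by linarith) hQ
    exact X.false_of_high_excursion (s := s) (q := p) (t := t) (e := P - 1) hsp hpt (by omega) (by omega) hs1 ht2
      (fun i a b => ⟨lowfree₁ i (by omega), if h : i ≤ p then hs3 i a h else ht4 i (by omega) b⟩)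
      (by linarith) hPm' (by linarith)
  rcases Nat.lt_or_ge p P with h2 | h2
  · exact hc1 ⟨by omega, h2⟩
  rcases Nat.lt_or_ge p (P' + 1) with h3 | h3
  · -- `p ∈ [P, P']`: a low excursion
    obtain ⟨s, hPs, hsp, hs1, hs3⟩ := exists_last_lt (h := X.hgt) h2 hP (by linarith)
    obtain ⟨t, hpt, htP', ht2, ht4⟩ := exists_first_lt (h := X.hgt) (show p ≤ P' by omega) (by linarith) hP'
    exact X.false_of_low_excursion (s := s) (q := p) (t := t) (e := R - 1) hsp hpt (by omega) (by omega) hs1 ht2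
      (fun i a b => ⟨if h : i ≤ p then hs3 i a h else ht4 i (by omega) b, highfree i (by omega) (by omega)⟩)
      (by linarith) hRm' (by linarith)
  rcases Nat.lt_or_ge p R with h4 | h4
  · exact hc2 ⟨by omega, h4⟩
  · -- `p ∈ [R, N)`: a high excursion
    obtain ⟨s, hRs, hsp, hs1, hs3⟩ := exists_last_gt (h := X.hgt) h4 hR (by linarith)
    obtain ⟨t, hpt, htN, ht2, ht4⟩ := exists_first_gt (h := X.hgt) hpN.le (by linarith) hN.2
    exact X.false_of_high_excursion (s := s) (q := p) (t := t) (e := P - 1 + X.N) hsp hpt (by omega) (by omega) hs1 ht2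
      (fun i a b => ⟨lowfree₂ i (by omega) (by omega), if h : i ≤ p then hs3 i a h else ht4 i (by omega) b⟩)
      (by linarith) hPmN (by linarith)

/-- **The skeleton exists.** [folklore] -/
theorem exists_skel : Nonempty X.Skel := by
  obtain ⟨hm, hκ, hκm, hw₁, hw₂⟩ := X.numer
  have hN := X.hgt_zero
  obtain ⟨p₀, hp₀0, hp₀N, hp₀⟩ := X.exists_low
  -- `P` first low, `Q` last high before it, `R` first high after it, `P'` last low before `R`
  obtain ⟨P, hP0, hPp₀, hPlow, hPmin⟩ := exists_first_lt (h := X.hgt) (Nat.zero_le p₀) (by linarith [hN.1]) hp₀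
  obtain ⟨Q, -, hQP', hQhigh, hQmax⟩ := exists_last_gt (h := X.hgt) (Nat.zero_le P) hN.1 (by linarith)
  have hQP : Q + 1 < P := by
    by_contra h
    have e : Q + 1 = P := by omega
    have := (X.hgt_succ_bounds Q).1; rw [e] at this; linarith
  have hPN : P < X.N := by omega
  obtain ⟨R, hPR, hRN, hRhigh, hRmin⟩ := exists_first_gt (h := X.hgt) hPN.le (by linarith) hN.2
  obtain ⟨P', hPP', hP'R', hP'low, hP'max⟩ := exists_last_lt (h := X.hgt) hPR.le hPlow (by linarith)
  have hP'R : P' + 1 < R := by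
    by_contra h
    have e : P' + 1 = R := by omega
    have := (X.hgt_succ_bounds P').2; rw [e] at this; linarith
  have lowfree₁ : ∀ i, i < P → X.w₁ + X.κ ≤ X.hgt i := fun i hi => hPmin i (Nat.zero_le i) hi
  have highfree : ∀ i, Q < i → i < R → X.hgt i ≤ X.w₂ - X.κ := fun i a b =>
    if h : i ≤ P then hQmax i a h else hRmin i (by omega) b
  have hmid₁ : ∀ i, Q < i → i < P → X.w₁ + X.κ ≤ X.hgt i ∧ X.hgt i ≤ X.w₂ - X.κ := fun i a b =>
    ⟨lowfree₁ i b, highfree i a (by omega)⟩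
  have hmid₂ : ∀ i, P' < i → i < R → X.w₁ + X.κ ≤ X.hgt i ∧ X.hgt i ≤ X.w₂ - X.κ := fun i a b =>
    ⟨hP'max i a b.le, highfree i (by omega) b⟩
  have hafter := X.no_low_after hQP hPP' hP'R hRN hQhigh hPlow hP'low hRhigh hmid₁ hmid₂
  have lowfree₂ : ∀ i, P' < i → i ≤ X.N → X.w₁ + X.κ ≤ X.hgt i := fun i a b =>
    if h : i ≤ R then hP'max i a h else hafter i (by omega) b
  exact ⟨⟨Q, P, P', R, hQP, hPP', hP'R, hRN, hQhigh, hPlow, hP'low, hRhigh, lowfree₁, highfree, lowfree₂,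
    X.hands_ne_of_valley (by omega) hPP' (by omega) (by omega) hQhigh hPlow hP'low hRhigh hmid₁ hmid₂,
    fun p hp h1 h2 => X.deep_mem hQP hPP' hP'R hRN hQhigh hPlow hP'low hRhigh lowfree₁ highfree lowfree₂ hp h1 h2⟩⟩

end WSetting

end WindowRect

/-- **The boundary cycle of the window edge set has a skeleton**, closed form (registered sub-goal of
stmt-CriticalPhenomena-10650). [folklore] -/
theorem windowRect_exists_skel : ∀ (X : WindowRect.WSetting), Nonempty X.Skel :=
  fun X => X.exists_skel

end Summit.CriticalPhenomena.SAWScalingLimit.Theorems.IsingBoundaryRatio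

end
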